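import Mathlib
import Summits.MatrixMultiplication.MatrixMultiplication.Theses.CubicExchangeSplit
import Summits.MatrixMultiplication.MatrixMultiplication.Theorems.ShapeSubmodularityShapeSubmodularCoreReduction

/-!
# `ShapeSubmodular` decomposed: `CubicAmortisation → CubicExchange → ShapeSubmodular`

Crux `ShapeSubmodular` (SUBMOD; stmt-MatrixMultiplication-15622, route `ShapeSubmodularity`, closed
`superseded:route-MatrixMultiplication-CubicExchangeSplit` 2026-08-17T14:08Z) is kernel-equivalent to the summit
`ω(ℂ) = 2` (`Theorems.ShapeSubmodular.ShapeSubmodular_of_omega_eq_two`, p150686, for `←`; the route's former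
deciding theorem with the proved crux E = `PerfectAmortisation` for `→`).  Its honest redirect (BC2, human ruling
2026-08-16) is the TYPED DECOMPOSITION filed as route `CubicExchangeSplit` (lens 3.4): the two cubic conjuncts

* `CubicAmortisation` (E₃, stmt-18000): `R⟨n,n,n³⟩ = O(n^{4+ε})` for every `ε > 0` (`ω(1,1,3) = 4`), and
* `CubicExchange` (SUBMOD₃, stmt-18001): the exchange law at the single lattice pair `(3,1,1) & (1,3,1)`,

each a consequence of `ω = 2` and neither known to give it alone (E₃ ⇒ `ω ≤ 12/5`, SUBMOD₃ ⇒ `ω ≤ 2(ω(1,1,3) − 3)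
≤ 2.397618` only).  This file PROVES THE ASSEMBLY of that decomposition for the leaf `X = ShapeSubmodular`:
`CubicAmortisation → CubicExchange → ShapeSubmodular` — the route item `CubicExchangeSplit.ShapeSubmodularOfSubs`
(stmt-MatrixMultiplication-18007) BY NAME.  Proof: the deciding theorem `CubicExchangeSplit.closes` gives
`ω(ℂ) = 2` from the two conjuncts; `ω = 2 → SUBMOD` is the landed `ShapeSubmodular_of_omega_eq_two` (the flattening
function `max(a+b, b+c, a+c)` is lattice-submodular).  The seam is short by design (Wiles shape: FLT ⇐ Modularity ∧
(Modularity ⇒ FLT)); the content sits in `closes` (flattening on the join `⟨n³,n³,n⟩`, format rotations) and in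
`ShapeSubmodular_of_alpha_eq_one` (α = 1 ⇒ every format is flattening-tight).  No new definitions; axioms standard.
-/

set_option linter.dupNamespace false
-- (single-conjunct summit: the namespace repeats `MatrixMultiplication`)

namespace Summit.MatrixMultiplication.MatrixMultiplication.Theorems.ShapeSubmodularOfSubs

open Literature.Computability.AlgebraicComplexity

/-- `E₃ ∧ SUBMOD₃ → ω(ℂ) = 2`: the deciding theorem of route `CubicExchangeSplit`, exponent form. [folklore] -/
theorem omega_eq_two_of_subs
    (hA : Summit.MatrixMultiplication.MatrixMultiplication.Theses.CubicExchangeSplit.CubicAmortisation)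
    (hX : Summit.MatrixMultiplication.MatrixMultiplication.Theses.CubicExchangeSplit.CubicExchange) :
    omega ℂ = 2 :=
  (_root_.MatrixMultiplication_iff).1
    (Summit.MatrixMultiplication.MatrixMultiplication.Theses.CubicExchangeSplit.closes hA hX)

/-- **`E₃ → SUBMOD₃ → SUBMOD`**: the two cubic conjuncts of route `CubicExchangeSplit` imply the whole lattice
exchange law `ShapeSubmodular` (through `ω(ℂ) = 2` and the landed `ShapeSubmodular_of_omega_eq_two`). [folklore] -/
theorem ShapeSubmodular_of_subs
    (hA : Summit.MatrixMultiplication.MatrixMultiplication.Theses.CubicExchangeSplit.CubicAmortisation)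
    (hX : Summit.MatrixMultiplication.MatrixMultiplication.Theses.CubicExchangeSplit.CubicExchange) :
    Summit.MatrixMultiplication.MatrixMultiplication.Theses.ShapeSubmodularity.ShapeSubmodular :=
  Summit.MatrixMultiplication.MatrixMultiplication.Theorems.ShapeSubmodular.ShapeSubmodular_of_omega_eq_two
    (omega_eq_two_of_subs hA hX)

/-- Route item `CubicExchangeSplit.ShapeSubmodularOfSubs` (stmt-MatrixMultiplication-18007) BY NAME: the
`X_of_subs` assembly for the ceiling leaf `X = ShapeSubmodular`, with `ShapeSubmodular`'s signature inlined.
[folklore] -/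
theorem shapeSubmodularOfSubs_proof :
    Summit.MatrixMultiplication.MatrixMultiplication.Theses.CubicExchangeSplit.ShapeSubmodularOfSubs :=
  fun hA hX => ShapeSubmodular_of_subs hA hX

end Summit.MatrixMultiplication.MatrixMultiplication.Theorems.ShapeSubmodularOfSubs
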